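import Mathlib
import Summits.Ventures.PercRepro2.HCov
import Summits.Ventures.PercRepro2.GcSkelRules
import Summits.Ventures.PercRepro2.GcSeries
import Summits.Ventures.PercRepro2.GcTransport
import Summits.Ventures.PercRepro2.GcTransportMarks

/-!
# The hat: an unmarked vertex on both roots and one further vertex — connectivity
(blind cell PercRepro2, typer-1 g56)

A HAT is a vertex `u` whose non-loop edges are exactly `e₁ = {u, a₁}`, `e₂ = {u, a₂}` and
`e₃ = {u, w}` (`IsHatAt`). On the configurations in which `e₁, e₂` are not both open (`HatG`)
— every configuration of `Q = {a₁ ↮ a₂}` — the hat acts on the rest of the graph through one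
of three patterns: nothing, `a₁ – w` (`e₁, e₃` open), `a₂ – w` (`e₂, e₃` open). The graph
`hatGraph` carries the patterns on two independent edges, `e₃ = {a₁, w}` and `e₂ = {w, a₂}`
(`e₁` a loop), and the configuration map `hatMap` sends a configuration to its pattern:

* **`conn_hat_none`** — for `x, z ≠ u` and a configuration with no open pattern, `x ↔ z` under
  `ω` in `G` iff `x ↔ z` under `hatMap ω` in `hatGraph` (the closed gadget edges re-routed to
  loops, at most one of them a leaf edge at `u`); the two patterns and the full
  **`conn_hatGraph_iff`** are `GcHatConnPattern.lean`;
* **`mem_HatG_of_not_conn`** — a configuration with `a₁ ↮ a₂` is in `HatG`; its mirror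
  **`conn_roots_of_not_mem_HatG`**, and **`conn_roots_hat_of_not_mem_HatG`** on the hat graph
  (`a₁ ↔ w ↔ a₂` when both pattern edges are open).

The measure side (the hat law is `c` times the product law of the two pattern edges on `HatG`) is
`GcHatPush.lean`; the scaling `Gc = c³ · Gc'` is `GcHat.lean`. Standard axioms.
-/

namespace Summit.Ventures.PercRepro2

open CovForm Contract RECM WRed

namespace Hat

section Defs

variable {V : Type*} {E : Type*}

/-- **A hat**: `u` carries exactly the three non-loop edges `e₁ = {u, a₁}`, `e₂ = {u, a₂}`,
`e₃ = {u, w}`. -/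
structure IsHatAt (ends : E → Sym2 V) (u a₁ a₂ w : V) (e₁ e₂ e₃ : E) : Prop where
  /-- `e₁ = {a₁, u}` -/
  h1 : ends e₁ = s(a₁, u)
  /-- `e₂ = {a₂, u}` -/
  h2 : ends e₂ = s(a₂, u)
  /-- `e₃ = {w, u}` -/
  h3 : ends e₃ = s(w, u)
  /-- the three edges are distinct -/
  e12 : e₁ ≠ e₂
  /-- the three edges are distinct -/
  e13 : e₁ ≠ e₃
  /-- the three edges are distinct -/
  e23 : e₂ ≠ e₃
  /-- `u ≠ a₁` -/
  ua1 : u ≠ a₁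
  /-- `u ≠ a₂` -/
  ua2 : u ≠ a₂
  /-- `u ≠ w` -/
  uw : u ≠ w
  /-- `w ≠ a₁` (no parallel edge) -/
  wa1 : w ≠ a₁
  /-- `w ≠ a₂` (no parallel edge) -/
  wa2 : w ≠ a₂
  /-- every other edge at `u` is a loop -/
  other : ∀ g, g ≠ e₁ → g ≠ e₂ → g ≠ e₃ → u ∈ ends g → (ends g).IsDiag

variable [DecidableEq E]

/-- **The hat graph**: `e₁` a loop at `a₁`, `e₂ = {w, a₂}`, `e₃ = {a₁, w}`; `u` isolated. -/
def hatGraph (ends : E → Sym2 V) (a₁ a₂ w : V) (e₁ e₂ e₃ : E) : E → Sym2 V :=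
  Function.update (Function.update (Function.update ends e₁ s(a₁, a₁)) e₂ s(w, a₂)) e₃ s(a₁, w)

/-- **The hat map**: `e₃` open iff `e₁` and `e₃` were (the pattern `a₁ – w`), `e₂` open iff `e₂`
and `e₃` were (`a₂ – w`), `e₁` closed. -/
def hatMap (e₁ e₂ e₃ : E) (ω : Config E) : Config E :=
  Function.update (Function.update (Function.update ω e₁ false) e₂ (ω e₂ && ω e₃)) e₃
    (ω e₁ && ω e₃)

/-- **The admissible configurations**: the two root edges of the hat are not both open. -/
def HatG (e₁ e₂ : E) : Set (Config E) := {ω | ¬ (ω e₁ = true ∧ ω e₂ = true)}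

end Defs

section Apply

variable {V : Type*} {E : Type*} [DecidableEq E] {ends : E → Sym2 V} {u a₁ a₂ w : V} {e₁ e₂ e₃ : E}

/-- The hat graph at `e₁`: a loop at `a₁`. -/
lemma hatGraph_e1 (h : IsHatAt ends u a₁ a₂ w e₁ e₂ e₃) : hatGraph ends a₁ a₂ w e₁ e₂ e₃ e₁ = s(a₁, a₁) := by
  simp [hatGraph, Function.update_of_ne h.e13, Function.update_of_ne h.e12]

/-- The hat graph at `e₂`: the pattern edge `{w, a₂}`. -/
lemma hatGraph_e2 (h : IsHatAt ends u a₁ a₂ w e₁ e₂ e₃) : hatGraph ends a₁ a₂ w e₁ e₂ e₃ e₂ = s(w, a₂) := by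
  simp [hatGraph, Function.update_of_ne h.e23]

/-- The hat graph at `e₃`: the pattern edge `{a₁, w}`. -/
lemma hatGraph_e3 : hatGraph ends a₁ a₂ w e₁ e₂ e₃ e₃ = s(a₁, w) := by
  simp [hatGraph]

/-- The hat graph off the gadget. -/
lemma hatGraph_of_ne {g : E} (h1 : g ≠ e₁) (h2 : g ≠ e₂) (h3 : g ≠ e₃) :
    hatGraph ends a₁ a₂ w e₁ e₂ e₃ g = ends g := by
  simp [hatGraph, Function.update_of_ne h1, Function.update_of_ne h2, Function.update_of_ne h3]

/-- The hat map at `e₁`: closed. -/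
lemma hatMap_e1 (h : IsHatAt ends u a₁ a₂ w e₁ e₂ e₃) (ω : Config E) : hatMap e₁ e₂ e₃ ω e₁ = false := by
  simp [hatMap, Function.update_of_ne h.e13, Function.update_of_ne h.e12]

/-- The hat map at `e₂`: the pattern `a₂ – w`. -/
lemma hatMap_e2 (h : IsHatAt ends u a₁ a₂ w e₁ e₂ e₃) (ω : Config E) :
    hatMap e₁ e₂ e₃ ω e₂ = (ω e₂ && ω e₃) := by
  simp [hatMap, Function.update_of_ne h.e23]

/-- The hat map at `e₃`: the pattern `a₁ – w`. -/
lemma hatMap_e3 (ω : Config E) : hatMap e₁ e₂ e₃ ω e₃ = (ω e₁ && ω e₃) := by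
  simp [hatMap]

/-- The hat map off the gadget. -/
lemma hatMap_of_ne {g : E} (ω : Config E) (h1 : g ≠ e₁) (h2 : g ≠ e₂) (h3 : g ≠ e₃) :
    hatMap e₁ e₂ e₃ ω g = ω g := by
  simp [hatMap, Function.update_of_ne h1, Function.update_of_ne h2, Function.update_of_ne h3]

omit [DecidableEq E] in
/-- A configuration with `a₁ ↮ a₂` is admissible. -/
lemma mem_HatG_of_not_conn (h : IsHatAt ends u a₁ a₂ w e₁ e₂ e₃) {ω : Config E}
    (hc : ¬ Conn ends ω a₁ a₂) : ω ∈ HatG e₁ e₂ := by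
  rintro ⟨h1, h2⟩
  exact hc (conn_trans (conn_ends_of_open h.h1 h1) (conn_symm (conn_ends_of_open h.h2 h2)))

omit [DecidableEq E] in
/-- Outside `HatG`, `a₁ ↔ a₂` through `u`. -/
lemma conn_roots_of_not_mem_HatG (h : IsHatAt ends u a₁ a₂ w e₁ e₂ e₃) {ω : Config E}
    (hω : ω ∉ HatG e₁ e₂) : Conn ends ω a₁ a₂ := by
  have h12 : ω e₁ = true ∧ ω e₂ = true := by
    by_contra hc
    exact hω hc
  exact conn_trans (conn_ends_of_open h.h1 h12.1) (conn_symm (conn_ends_of_open h.h2 h12.2))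

/-- Outside `HatG`, `a₁ ↔ a₂` through `w` on the hat graph (`e₁` is a loop there, so the two
pattern edges `e₃ = {a₁, w}` and `e₂ = {w, a₂}` are meant). -/
lemma conn_roots_hat_of_not_mem_HatG (h : IsHatAt ends u a₁ a₂ w e₁ e₂ e₃) {ω : Config E}
    (hω : ω ∉ HatG e₂ e₃) : Conn (hatGraph ends a₁ a₂ w e₁ e₂ e₃) ω a₁ a₂ := by
  have h23 : ω e₂ = true ∧ ω e₃ = true := by
    by_contra hc
    exact hω hc
  exact conn_trans (conn_ends_of_open (hatGraph_e3 (ends := ends) (e₁ := e₁) (e₂ := e₂)) h23.2)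
    (conn_ends_of_open (hatGraph_e2 h) h23.1)

end Apply

section Conn

variable {V : Type*} {E : Type*} [DecidableEq V] [DecidableEq E] {ends : E → Sym2 V}
  {u a₁ a₂ w : V} {e₁ e₂ e₃ : E}

omit [DecidableEq V] in
/-- A closed edge may be re-routed to a loop. -/
lemma conn_loop_of_closed {ω : Config E} {g : E} (hg : ω g = false) (v x z : V) :
    Conn ends ω x z ↔ Conn (Function.update ends g s(v, v)) ω x z := by
  have := conn_update_false_iff_loop ends g v ω x z
  rwa [Function.update_eq_self_iff.2 hg.symm] at this

omit [DecidableEq V] in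
/-- Two graphs agreeing off the gadget, with the gadget edges loops in both, connect alike. -/
lemma agree_loops (h : IsHatAt ends u a₁ a₂ w e₁ e₂ e₃) {ends₁ ends₂ : E → Sym2 V}
    (h₁ : ∀ g, g ≠ e₁ → g ≠ e₂ → g ≠ e₃ → ends₁ g = ends g)
    (h₂ : ∀ g, g ≠ e₁ → g ≠ e₂ → g ≠ e₃ → ends₂ g = ends g)
    (l₁ : (ends₁ e₁).IsDiag) (l₂ : (ends₁ e₂).IsDiag) (l₃ : (ends₁ e₃).IsDiag)
    (m₁ : (ends₂ e₁).IsDiag) (m₂ : (ends₂ e₂).IsDiag) (m₃ : (ends₂ e₃).IsDiag) (ω : Config E)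
    (x z : V) : Conn ends₁ ω x z ↔ Conn ends₂ ω x z := by
  have _ := h
  refine conn_iff_of_agree_nonLoop ?_ ?_ ω x z
  · intro g hg
    by_cases g1 : g = e₁
    · exact absurd (g1 ▸ l₁) hg
    by_cases g2 : g = e₂
    · exact absurd (g2 ▸ l₂) hg
    by_cases g3 : g = e₃
    · exact absurd (g3 ▸ l₃) hg
    rw [h₁ g g1 g2 g3, h₂ g g1 g2 g3]
  · intro g hg
    by_cases g1 : g = e₁
    · exact absurd (g1 ▸ m₁) hg
    by_cases g2 : g = e₂
    · exact absurd (g2 ▸ m₂) hg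
    by_cases g3 : g = e₃
    · exact absurd (g3 ▸ m₃) hg
    rw [h₁ g g1 g2 g3, h₂ g g1 g2 g3]

omit [DecidableEq V] in
/-- `hatMap` at a configuration with no open pattern closes the three gadget edges. -/
lemma hatMap_eq_of_none (h : IsHatAt ends u a₁ a₂ w e₁ e₂ e₃) {ω : Config E}
    (hn : ¬ (ω e₁ = true ∧ ω e₃ = true)) (hn' : ¬ (ω e₂ = true ∧ ω e₃ = true)) :
    hatMap e₁ e₂ e₃ ω =
      Function.update (Function.update (Function.update ω e₁ false) e₂ false) e₃ false := by
  funext g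
  by_cases g3 : g = e₃
  · rw [g3, hatMap_e3, Function.update_self]
    cases h1 : ω e₁ <;> cases hh : ω e₃ <;> simp_all
  by_cases g2 : g = e₂
  · rw [g2, hatMap_e2 h, Function.update_of_ne h.e23, Function.update_self]
    cases h2 : ω e₂ <;> cases hh : ω e₃ <;> simp_all
  by_cases g1 : g = e₁
  · rw [g1, hatMap_e1 h, Function.update_of_ne h.e13, Function.update_of_ne h.e12,
      Function.update_self]
  rw [hatMap_of_ne ω g1 g2 g3, Function.update_of_ne g3, Function.update_of_ne g2,
    Function.update_of_ne g1]

/-- The hat graph with its three gadget edges looped at `u`. -/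
def hatLoops (ends : E → Sym2 V) (u a₁ a₂ w : V) (e₁ e₂ e₃ : E) : E → Sym2 V :=
  Function.update (Function.update (Function.update (hatGraph ends a₁ a₂ w e₁ e₂ e₃) e₁ s(u, u)) e₂
    s(u, u)) e₃ s(u, u)

omit [DecidableEq V] in
/-- The looped hat graph off the gadget. -/
lemma hatLoops_of_ne {g : E} (h1 : g ≠ e₁) (h2 : g ≠ e₂) (h3 : g ≠ e₃) :
    hatLoops ends u a₁ a₂ w e₁ e₂ e₃ g = ends g := by
  simp [hatLoops, Function.update_of_ne h1, Function.update_of_ne h2, Function.update_of_ne h3,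
    hatGraph_of_ne h1 h2 h3]

omit [DecidableEq V] in
/-- The looped hat graph at `e₁`: a loop. -/
lemma hatLoops_e1 (h : IsHatAt ends u a₁ a₂ w e₁ e₂ e₃) :
    (hatLoops ends u a₁ a₂ w e₁ e₂ e₃ e₁).IsDiag := by
  simp [hatLoops, Function.update_of_ne h.e13, Function.update_of_ne h.e12]

omit [DecidableEq V] in
/-- The looped hat graph at `e₂`: a loop. -/
lemma hatLoops_e2 (h : IsHatAt ends u a₁ a₂ w e₁ e₂ e₃) :
    (hatLoops ends u a₁ a₂ w e₁ e₂ e₃ e₂).IsDiag := by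
  simp [hatLoops, Function.update_of_ne h.e23]

omit [DecidableEq V] in
/-- The looped hat graph at `e₃`: a loop. -/
lemma hatLoops_e3 : (hatLoops ends u a₁ a₂ w e₁ e₂ e₃ e₃).IsDiag := by
  simp [hatLoops]

omit [DecidableEq V] in
/-- On the hat graph, a configuration with its gadget edges closed connects as the looped graph
under the original configuration. -/
lemma conn_hat_closed (h : IsHatAt ends u a₁ a₂ w e₁ e₂ e₃) (ω : Config E) (x z : V) :
    Conn (hatGraph ends a₁ a₂ w e₁ e₂ e₃)
        (Function.update (Function.update (Function.update ω e₁ false) e₂ false) e₃ false) x z ↔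
      Conn (hatLoops ends u a₁ a₂ w e₁ e₂ e₃) ω x z := by
  rw [conn_loop_of_closed (g := e₁) (by simp [Function.update_of_ne h.e13,
      Function.update_of_ne h.e12]) u,
    conn_loop_of_closed (g := e₂) (by simp [Function.update_of_ne h.e23]) u,
    conn_loop_of_closed (g := e₃) (by simp) u]
  show Conn (hatLoops ends u a₁ a₂ w e₁ e₂ e₃) _ x z ↔ _
  rw [conn_update_of_isDiag _ hatLoops_e3, conn_update_of_isDiag _ (hatLoops_e2 h),
    conn_update_of_isDiag _ (hatLoops_e1 h)]

omit [DecidableEq V] in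
/-- A graph that agrees with `ends` off the gadget and has the gadget edges as loops connects as
the looped hat graph. -/
lemma conn_loops_iff (h : IsHatAt ends u a₁ a₂ w e₁ e₂ e₃) {ends' : E → Sym2 V}
    (h' : ∀ g, g ≠ e₁ → g ≠ e₂ → g ≠ e₃ → ends' g = ends g) (l₁ : (ends' e₁).IsDiag)
    (l₂ : (ends' e₂).IsDiag) (l₃ : (ends' e₃).IsDiag) (ω : Config E) (x z : V) :
    Conn ends' ω x z ↔ Conn (hatLoops ends u a₁ a₂ w e₁ e₂ e₃) ω x z :=
  agree_loops h h' (fun _ g1 g2 g3 => hatLoops_of_ne g1 g2 g3) l₁ l₂ l₃ (hatLoops_e1 h)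
    (hatLoops_e2 h) hatLoops_e3 ω x z

omit [DecidableEq V] in
/-- **The hat is invisible when no pattern is open.** -/
lemma conn_hat_none (h : IsHatAt ends u a₁ a₂ w e₁ e₂ e₃) {ω : Config E}
    (hn : ¬ (ω e₁ = true ∧ ω e₃ = true)) (hn' : ¬ (ω e₂ = true ∧ ω e₃ = true))
    (hG : ω ∈ HatG e₁ e₂) {x z : V} (hx : x ≠ u) (hz : z ≠ u) :
    Conn ends ω x z ↔ Conn (hatGraph ends a₁ a₂ w e₁ e₂ e₃) (hatMap e₁ e₂ e₃ ω) x z := by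
  rw [hatMap_eq_of_none h hn hn', conn_hat_closed h]
  by_cases h3 : ω e₃ = true
  · -- `e₃` open, `e₁, e₂` closed: a leaf edge at `u`
    have h1 : ω e₁ = false := by
      cases hh : ω e₁
      · rfl
      · exact absurd ⟨hh, h3⟩ hn
    have h2 : ω e₂ = false := by
      cases hh : ω e₂
      · rfl
      · exact absurd ⟨hh, h3⟩ hn'
    rw [conn_loop_of_closed (g := e₁) h1 u, conn_loop_of_closed (g := e₂) h2 u]
    rw [conn_leaf_iff (e := e₃) (a₁ := w) (y := u)
      (by rw [Function.update_of_ne h.e23.symm, Function.update_of_ne h.e13.symm]; exact h.h3)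
      h.uw.symm ?_ ω hx hz]
    · refine conn_loops_iff h ?_ ?_ ?_ ?_ ω x z
      · intro g g1 g2 g3
        simp [Function.update_of_ne g1, Function.update_of_ne g2, Function.update_of_ne g3]
      · simp [Function.update_of_ne h.e13, Function.update_of_ne h.e12]
      · simp [Function.update_of_ne h.e23]
      · simp
    · intro g hg3 hg
      by_cases g2 : g = e₂
      · rw [g2, Function.update_self]; simp
      by_cases g1 : g = e₁
      · rw [g1, Function.update_of_ne h.e12, Function.update_self]; simp
      rw [Function.update_of_ne g2, Function.update_of_ne g1] at hg ⊢
      exact h.other g g1 g2 hg3 hg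
  · have h3' : ω e₃ = false := by
      cases hh : ω e₃
      · rfl
      · exact absurd hh h3
    rw [conn_loop_of_closed (g := e₃) h3' u]
    by_cases h1 : ω e₁ = true
    · -- `e₁` open, `e₂` closed: a leaf edge at `u`
      have h2 : ω e₂ = false := by
        cases hh : ω e₂
        · rfl
        · exact absurd ⟨h1, hh⟩ hG
      rw [conn_loop_of_closed (g := e₂) h2 u]
      rw [conn_leaf_iff (e := e₁) (a₁ := a₁) (y := u)
        (by rw [Function.update_of_ne h.e12, Function.update_of_ne h.e13]; exact h.h1)
        h.ua1.symm ?_ ω hx hz]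
      · refine conn_loops_iff h ?_ ?_ ?_ ?_ ω x z
        · intro g g1 g2 g3
          simp [Function.update_of_ne g1, Function.update_of_ne g2, Function.update_of_ne g3]
        · simp
        · simp [Function.update_of_ne h.e12.symm]
        · simp [Function.update_of_ne h.e13.symm, Function.update_of_ne h.e23.symm]
      · intro g hg1 hg
        by_cases g2 : g = e₂
        · rw [g2, Function.update_self]; simp
        by_cases g3 : g = e₃
        · rw [g3, Function.update_of_ne h.e23.symm, Function.update_self]; simp
        rw [Function.update_of_ne g2, Function.update_of_ne g3] at hg ⊢
        exact h.other g hg1 g2 g3 hg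
    · have h1' : ω e₁ = false := by
        cases hh : ω e₁
        · rfl
        · exact absurd hh h1
      rw [conn_loop_of_closed (g := e₁) h1' u]
      by_cases h2 : ω e₂ = true
      · -- `e₂` open alone: a leaf edge at `u`
        rw [conn_leaf_iff (e := e₂) (a₁ := a₂) (y := u)
          (by rw [Function.update_of_ne h.e12.symm, Function.update_of_ne h.e23]; exact h.h2)
          h.ua2.symm ?_ ω hx hz]
        · refine conn_loops_iff h ?_ ?_ ?_ ?_ ω x z
          · intro g g1 g2 g3
            simp [Function.update_of_ne g1, Function.update_of_ne g2, Function.update_of_ne g3]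
          · simp [Function.update_of_ne h.e12]
          · simp
          · simp [Function.update_of_ne h.e23.symm, Function.update_of_ne h.e13.symm]
        · intro g hg2 hg
          by_cases g1 : g = e₁
          · rw [g1, Function.update_self]; simp
          by_cases g3 : g = e₃
          · rw [g3, Function.update_of_ne h.e13.symm, Function.update_self]; simp
          rw [Function.update_of_ne g1, Function.update_of_ne g3] at hg ⊢
          exact h.other g g1 hg2 g3 hg
      · have h2' : ω e₂ = false := by
          cases hh : ω e₂
          · rfl
          · exact absurd hh h2
        rw [conn_loop_of_closed (g := e₂) h2' u]
        refine conn_loops_iff h ?_ ?_ ?_ ?_ ω x z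
        · intro g g1 g2 g3
          simp [Function.update_of_ne g1, Function.update_of_ne g2, Function.update_of_ne g3]
        · simp [Function.update_of_ne h.e12]
        · simp
        · simp [Function.update_of_ne h.e13.symm, Function.update_of_ne h.e23.symm]

end Conn

end Hat

end Summit.Ventures.PercRepro2
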